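import Summits.Langlands.Langlands.Theorems.SqrtFiveQuarticCoversJInSqrtFiveModular
import Summits.Langlands.Langlands.Theorems.SqrtFiveQuarticCoversTarget

/-!
# Route `Langlands/SqrtFiveQuarticCovers` — the crux `RefinedLocusModular` (and the route's `Target`)
# from FIVE FINITE CERTIFICATES and named print facts (CONDITIONAL bookkeeping; closes nothing)

Port to the tree of the assembly of record of the cell lead's statement-first typing file
(cell `pub/lg-quartmod`, F-L1; `HOME/lg-quartmod-lead/RefinedLocusTyping.lean` v4, sha16
aabe553c3a96c46d, theorem `RefinedLocusModular_of_certificates`), WITHOUT introducing Prop-valued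
definitions under `Summits/` (D-0027 §2.1): the five certificate statements are written out as
hypotheses.  Each certificate is the finite statement one E-sheet of the cell computes (CENSUS.md
§15): every elliptic curve `E` (integral model, `Δ ≠ 0`) over a totally real quartic `K ∋ √5` whose
mod-`p` images (for some framings of `E[p]`, written out as in the crux) lie in the stated pair /
triple of level structures is CM or has `j(E) = c₄³/Δ ∈ ℚ(√5)` (division-free:
`c₄³ = (a + b√5)·Δ`):

* `hA` — `b3 ∧ H8 ∧ (b7 ∨ e7)`, carrier `X(b3,H8) = X₀(75)^ε` (genus `5`): sheets 4.2 + 4.6 (the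
  mod-`7` disjunction is kept: the pair-level statement without it is false — four non-CM points
  over `K₁ = ℚ(θ)`, `θ⁴ − 35θ² + 205`, large at `7`);
* `hB7` — `H12 ∧ b7`, carrier `Z = X(H12,b7)` (genus `9`): sheets 4.1 + 4.3;
* `hC` — `s3 ∧ H8`, carrier `X(s3,H8) = (X₀(225)/w₉)^ε` (genus `9`): sheets 4.4 + 4.8;
* `hD` — `s3 ∧ H12`, carrier `X(s3,H12)` (genus `7`): sheet 4.7 (+ 4.3);
* `hE` — `b3 ∧ e7`, carrier `X(b3,e7)` (genus `9`, over `ℚ`): sheet 4.5.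

`refinedLocusModular_of_certificates`: the five certificates, together with the bridge
"`j ∈ ℚ(√5)` ⇒ modular" (tree theorem `jInSqrtFive_modular_of_facts`, eng-6, modulo the named facts
`FLS2015_theorem1` and `isModularEllipticCurve_baseChange_of_isSolvable_of_isAutomorphicOfWeightZero`)
imply the crux `RefinedLocusModular` — an 8-way case split on the crux's three image disjunctions.
`target_of_certificates_of_facts`: composed with `target_of_refinedLocusModular_of_facts`, the
route's `Target` (every `E` over every totally real quartic field is modular) from the five
certificates and SEVEN named print facts.

HONEST STATUS: conditional bookkeeping; the certificates are established by explicit computation in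
the cell (two method-disjoint lineages each), NOT in Lean — the tree has no carrier for modular
curves or their moduli interpretation; nothing here proves modularity of any curve.
References: [Box2022] §1.1–1.2, Thms. 1.1, 1.5, 7.1; [FreitasLeHungSiksek2015] Thm. 1, Thms. 3–4,
Remark (iii) after Cor. 2.1, §7; [Kalyanswamy2018] Thm. 1.2.
-/

set_option linter.dupNamespace false -- project-wide option (lakefile weak.linter.dupNamespace); `Summit.Langlands.Langlands` is the mandated namespace

namespace Summit.Langlands.Langlands.Theorems.SqrtFiveQuarticCovers

open scoped Matrix
open Literature.NumberTheory.Automorphic Summit.Langlands.Langlands.Theses.SqrtFiveQuarticCovers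

/-- **The crux `RefinedLocusModular` from five finite certificates** (written out; see the module
docstring for which sheet / carrier each is) **and the two named facts behind the bridge
`j ∈ ℚ(√5) ⇒ modular`.**  Proof: split the crux's image disjunctions at `3`, `5`, `7`; in each of the
eight cases one certificate applies (`H8`: `hA` if `b3`, `hC` if `s3`; `H12`: `hB7` if `b7`, else
`hE` if `b3`, `hD` if `s3`) and gives CM (first alternative of modularity) or `j ∈ ℚ(√5)` (then
`jInSqrtFive_modular_of_facts`).  CONDITIONAL; kernel-checked logic only.
[cite: Box2022, §1.1 and Thm. 7.1] [cite: FreitasLeHungSiksek2015, Thm. 1 and §7] -/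
theorem refinedLocusModular_of_certificates
    (hA : ∀ (K : Type) [Field K] [NumberField K], NumberField.IsTotallyReal K → Module.finrank ℚ K = 4 → (∃ r : K, r ^ 2 = 5) →
        ∀ E : WeierstrassCurve (NumberField.RingOfIntegers K), E.Δ ≠ 0 →
          (∃ ρ : Literature.NumberTheory.GaloisRepresentations.FramedGaloisRep K (ZMod 3) 2, (∃ e : (E.baseChange K).geomTorsion ((3 : ℕ) : ℤ) ≃+ (Fin 2 → ZMod 3), ∀ (σ : Field.absoluteGaloisGroup K) (P : (E.baseChange K).geomTorsion ((3 : ℕ) : ℤ)), e (σ • P) = ((ρ σ : GL (Fin 2) (ZMod 3)) : Matrix (Fin 2) (Fin 2) (ZMod 3)) *ᵥ (e P)) ∧ ((∀ σ : Field.absoluteGaloisGroup K, (((ρ σ : GL (Fin 2) (ZMod 3)) : Matrix (Fin 2) (Fin 2) (ZMod 3)) 1 0 = 0)))) →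
          (∃ ρ : Literature.NumberTheory.GaloisRepresentations.FramedGaloisRep K (ZMod 5) 2, (∃ e : (E.baseChange K).geomTorsion ((5 : ℕ) : ℤ) ≃+ (Fin 2 → ZMod 5), ∀ (σ : Field.absoluteGaloisGroup K) (P : (E.baseChange K).geomTorsion ((5 : ℕ) : ℤ)), e (σ • P) = ((ρ σ : GL (Fin 2) (ZMod 5)) : Matrix (Fin 2) (Fin 2) (ZMod 5)) *ᵥ (e P)) ∧ ((∀ σ : Field.absoluteGaloisGroup K, (ρ σ : GL (Fin 2) (ZMod 5)) ∈ Subgroup.closure ({(⟨!![2, 0; 0, 3], !![3, 0; 0, 2], by decide, by decide⟩ : GL (Fin 2) (ZMod 5)), (⟨!![0, 1; 1, 0], !![0, 1; 1, 0], by decide, by decide⟩ : GL (Fin 2) (ZMod 5))} : Set (GL (Fin 2) (ZMod 5)))))) →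
          ((∃ ρ : Literature.NumberTheory.GaloisRepresentations.FramedGaloisRep K (ZMod 7) 2, (∃ e : (E.baseChange K).geomTorsion ((7 : ℕ) : ℤ) ≃+ (Fin 2 → ZMod 7), ∀ (σ : Field.absoluteGaloisGroup K) (P : (E.baseChange K).geomTorsion ((7 : ℕ) : ℤ)), e (σ • P) = ((ρ σ : GL (Fin 2) (ZMod 7)) : Matrix (Fin 2) (Fin 2) (ZMod 7)) *ᵥ (e P)) ∧ ((∀ σ : Field.absoluteGaloisGroup K, (((ρ σ : GL (Fin 2) (ZMod 7)) : Matrix (Fin 2) (Fin 2) (ZMod 7)) 1 0 = 0)))) ∨ (∃ ρ : Literature.NumberTheory.GaloisRepresentations.FramedGaloisRep K (ZMod 7) 2, (∃ e : (E.baseChange K).geomTorsion ((7 : ℕ) : ℤ) ≃+ (Fin 2 → ZMod 7), ∀ (σ : Field.absoluteGaloisGroup K) (P : (E.baseChange K).geomTorsion ((7 : ℕ) : ℤ)), e (σ • P) = ((ρ σ : GL (Fin 2) (ZMod 7)) : Matrix (Fin 2) (Fin 2) (ZMod 7)) *ᵥ (e P)) ∧ ((∀ σ : Field.absoluteGaloisGroup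 K, (ρ σ : GL (Fin 2) (ZMod 7)) ∈ Subgroup.closure ({(⟨!![0, 5; 3, 0], !![0, 5; 3, 0], by decide, by decide⟩ : GL (Fin 2) (ZMod 7)), (⟨!![5, 0; 3, 2], !![3, 0; 6, 4], by decide, by decide⟩ : GL (Fin 2) (ZMod 7))} : Set (GL (Fin 2) (ZMod 7))))))) →
          ((E.baseChange K).HasCM ∨ (∃ r : K, r ^ 2 = 5 ∧ ∃ a b : ℚ, (E.baseChange K).c₄ ^ 3 = ((a : K) + (b : K) * r) * (E.baseChange K).Δ)))
    (hB7 : ∀ (K : Type) [Field K] [NumberField K], NumberField.IsTotallyReal K → Module.finrank ℚ K = 4 → (∃ r : K, r ^ 2 = 5) →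
        ∀ E : WeierstrassCurve (NumberField.RingOfIntegers K), E.Δ ≠ 0 →
          (∃ ρ : Literature.NumberTheory.GaloisRepresentations.FramedGaloisRep K (ZMod 5) 2, (∃ e : (E.baseChange K).geomTorsion ((5 : ℕ) : ℤ) ≃+ (Fin 2 → ZMod 5), ∀ (σ : Field.absoluteGaloisGroup K) (P : (E.baseChange K).geomTorsion ((5 : ℕ) : ℤ)), e (σ • P) = ((ρ σ : GL (Fin 2) (ZMod 5)) : Matrix (Fin 2) (Fin 2) (ZMod 5)) *ᵥ (e P)) ∧ ((∀ σ : Field.absoluteGaloisGroup K, (ρ σ : GL (Fin 2) (ZMod 5)) ∈ Subgroup.closure ({(⟨!![3, 1; 3, 3], !![3, 4; 2, 3], by decide, by decide⟩ : GL (Fin 2) (ZMod 5)), (⟨!![1, 0; 0, 4], !![1, 0; 0, 4], by decide, by decide⟩ : GL (Fin 2) (ZMod 5))} : Set (GL (Fin 2) (ZMod 5)))))) →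
          (∃ ρ : Literature.NumberTheory.GaloisRepresentations.FramedGaloisRep K (ZMod 7) 2, (∃ e : (E.baseChange K).geomTorsion ((7 : ℕ) : ℤ) ≃+ (Fin 2 → ZMod 7), ∀ (σ : Field.absoluteGaloisGroup K) (P : (E.baseChange K).geomTorsion ((7 : ℕ) : ℤ)), e (σ • P) = ((ρ σ : GL (Fin 2) (ZMod 7)) : Matrix (Fin 2) (Fin 2) (ZMod 7)) *ᵥ (e P)) ∧ ((∀ σ : Field.absoluteGaloisGroup K, (((ρ σ : GL (Fin 2) (ZMod 7)) : Matrix (Fin 2) (Fin 2) (ZMod 7)) 1 0 = 0)))) →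
          ((E.baseChange K).HasCM ∨ (∃ r : K, r ^ 2 = 5 ∧ ∃ a b : ℚ, (E.baseChange K).c₄ ^ 3 = ((a : K) + (b : K) * r) * (E.baseChange K).Δ)))
    (hC : ∀ (K : Type) [Field K] [NumberField K], NumberField.IsTotallyReal K → Module.finrank ℚ K = 4 → (∃ r : K, r ^ 2 = 5) →
        ∀ E : WeierstrassCurve (NumberField.RingOfIntegers K), E.Δ ≠ 0 →
          (∃ ρ : Literature.NumberTheory.GaloisRepresentations.FramedGaloisRep K (ZMod 3) 2, (∃ e : (E.baseChange K).geomTorsion ((3 : ℕ) : ℤ) ≃+ (Fin 2 → ZMod 3), ∀ (σ : Field.absoluteGaloisGroup K) (P : (E.baseChange K).geomTorsion ((3 : ℕ) : ℤ)), e (σ • P) = ((ρ σ : GL (Fin 2) (ZMod 3)) : Matrix (Fin 2) (Fin 2) (ZMod 3)) *ᵥ (e P)) ∧ ((∀ σ : Field.absoluteGaloisGroup K, (ρ σ : GL (Fin 2) (ZMod 3)) ∈ Subgroup.closure ({(⟨!![1, 0; 0, 2], !![1, 0; 0, 2], by decide, by decide⟩ : GL (Fin 2) (ZMod 3)), (⟨!![0,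 1; 1, 0], !![0, 1; 1, 0], by decide, by decide⟩ : GL (Fin 2) (ZMod 3))} : Set (GL (Fin 2) (ZMod 3)))))) →
          (∃ ρ : Literature.NumberTheory.GaloisRepresentations.FramedGaloisRep K (ZMod 5) 2, (∃ e : (E.baseChange K).geomTorsion ((5 : ℕ) : ℤ) ≃+ (Fin 2 → ZMod 5), ∀ (σ : Field.absoluteGaloisGroup K) (P : (E.baseChange K).geomTorsion ((5 : ℕ) : ℤ)), e (σ • P) = ((ρ σ : GL (Fin 2) (ZMod 5)) : Matrix (Fin 2) (Fin 2) (ZMod 5)) *ᵥ (e P)) ∧ ((∀ σ : Field.absoluteGaloisGroup K, (ρ σ : GL (Fin 2) (ZMod 5)) ∈ Subgroup.closure ({(⟨!![2, 0; 0, 3], !![3, 0; 0, 2], by decide, by decide⟩ : GL (Fin 2) (ZMod 5)), (⟨!![0, 1; 1, 0], !![0, 1; 1, 0], by decide, by decide⟩ : GL (Fin 2) (ZMod 5))} : Set (GL (Fin 2) (ZMod 5)))))) →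
          ((E.baseChange K).HasCM ∨ (∃ r : K, r ^ 2 = 5 ∧ ∃ a b : ℚ, (E.baseChange K).c₄ ^ 3 = ((a : K) + (b : K) * r) * (E.baseChange K).Δ)))
    (hD : ∀ (K : Type) [Field K] [NumberField K], NumberField.IsTotallyReal K → Module.finrank ℚ K = 4 → (∃ r : K, r ^ 2 = 5) →
        ∀ E : WeierstrassCurve (NumberField.RingOfIntegers K), E.Δ ≠ 0 →
          (∃ ρ : Literature.NumberTheory.GaloisRepresentations.FramedGaloisRep K (ZMod 3) 2, (∃ e : (E.baseChange K).geomTorsion ((3 : ℕ) : ℤ) ≃+ (Fin 2 → ZMod 3), ∀ (σ : Field.absoluteGaloisGroup K) (P : (E.baseChange K).geomTorsion ((3 : ℕ) : ℤ)), e (σ • P) = ((ρ σ : GL (Fin 2) (ZMod 3)) : Matrix (Fin 2) (Fin 2) (ZMod 3)) *ᵥ (e P)) ∧ ((∀ σ : Field.absoluteGaloisGroup K, (ρ σ : GL (Fin 2) (ZMod 3)) ∈ Subgroup.closure ({(⟨!![1, 0; 0, 2], !![1, 0; 0, 2], by decide, by decide⟩ : GL (Fin 2) (ZMod 3)), (⟨!![0,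 1; 1, 0], !![0, 1; 1, 0], by decide, by decide⟩ : GL (Fin 2) (ZMod 3))} : Set (GL (Fin 2) (ZMod 3)))))) →
          (∃ ρ : Literature.NumberTheory.GaloisRepresentations.FramedGaloisRep K (ZMod 5) 2, (∃ e : (E.baseChange K).geomTorsion ((5 : ℕ) : ℤ) ≃+ (Fin 2 → ZMod 5), ∀ (σ : Field.absoluteGaloisGroup K) (P : (E.baseChange K).geomTorsion ((5 : ℕ) : ℤ)), e (σ • P) = ((ρ σ : GL (Fin 2) (ZMod 5)) : Matrix (Fin 2) (Fin 2) (ZMod 5)) *ᵥ (e P)) ∧ ((∀ σ : Field.absoluteGaloisGroup K, (ρ σ : GL (Fin 2) (ZMod 5)) ∈ Subgroup.closure ({(⟨!![3, 1; 3, 3], !![3, 4; 2, 3], by decide, by decide⟩ : GL (Fin 2) (ZMod 5)), (⟨!![1, 0; 0, 4], !![1, 0; 0, 4], by decide, by decide⟩ : GL (Fin 2) (ZMod 5))} : Set (GL (Fin 2) (ZMod 5)))))) →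
          ((E.baseChange K).HasCM ∨ (∃ r : K, r ^ 2 = 5 ∧ ∃ a b : ℚ, (E.baseChange K).c₄ ^ 3 = ((a : K) + (b : K) * r) * (E.baseChange K).Δ)))
    (hE : ∀ (K : Type) [Field K] [NumberField K], NumberField.IsTotallyReal K → Module.finrank ℚ K = 4 → (∃ r : K, r ^ 2 = 5) →
        ∀ E : WeierstrassCurve (NumberField.RingOfIntegers K), E.Δ ≠ 0 →
          (∃ ρ : Literature.NumberTheory.GaloisRepresentations.FramedGaloisRep K (ZMod 3) 2, (∃ e : (E.baseChange K).geomTorsion ((3 : ℕ) : ℤ) ≃+ (Fin 2 → ZMod 3), ∀ (σ : Field.absoluteGaloisGroup K) (P : (E.baseChange K).geomTorsion ((3 : ℕ) : ℤ)), e (σ • P) = ((ρ σ : GL (Fin 2) (ZMod 3)) : Matrix (Fin 2) (Fin 2) (ZMod 3)) *ᵥ (e P)) ∧ ((∀ σ : Field.absoluteGaloisGroup K, (((ρ σ : GL (Fin 2) (ZMod 3)) : Matrix (Fin 2) (Fin 2) (ZMod 3)) 1 0 = 0)))) →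
          (∃ ρ : Literature.NumberTheory.GaloisRepresentations.FramedGaloisRep K (ZMod 7) 2, (∃ e : (E.baseChange K).geomTorsion ((7 : ℕ) : ℤ) ≃+ (Fin 2 → ZMod 7), ∀ (σ : Field.absoluteGaloisGroup K) (P : (E.baseChange K).geomTorsion ((7 : ℕ) : ℤ)), e (σ • P) = ((ρ σ : GL (Fin 2) (ZMod 7)) : Matrix (Fin 2) (Fin 2) (ZMod 7)) *ᵥ (e P)) ∧ ((∀ σ : Field.absoluteGaloisGroup K, (ρ σ : GL (Fin 2) (ZMod 7)) ∈ Subgroup.closure ({(⟨!![0, 5; 3, 0], !![0, 5; 3, 0], by decide, by decide⟩ : GL (Fin 2) (ZMod 7)), (⟨!![5, 0; 3, 2], !![3, 0; 6, 4], by decide, by decide⟩ : GL (Fin 2) (ZMod 7))} : Set (GL (Fin 2) (ZMod 7)))))) →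
          ((E.baseChange K).HasCM ∨ (∃ r : K, r ^ 2 = 5 ∧ ∃ a b : ℚ, (E.baseChange K).c₄ ^ 3 = ((a : K) + (b : K) * r) * (E.baseChange K).Δ)))
    (hFLS : FLS2015_theorem1)
    (hBC : isModularEllipticCurve_baseChange_of_isSolvable_of_isAutomorphicOfWeightZero) :
    RefinedLocusModular := by
  intro K _ _ hK hd hr E hΔ h3 h5 h7
  have bridge := jInSqrtFive_modular_of_facts hFLS hBC K hK hd hr E hΔ
  obtain ⟨ρ3, e3, h3'⟩ := h3
  obtain ⟨ρ5, e5, h5'⟩ := h5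
  obtain ⟨ρ7, e7, h7'⟩ := h7
  have finish : ((E.baseChange K).HasCM ∨ (∃ r : K, r ^ 2 = 5 ∧ ∃ a b : ℚ, (E.baseChange K).c₄ ^ 3 = ((a : K) + (b : K) * r) * (E.baseChange K).Δ)) →
      ((E.baseChange K).HasCM ∨ ∃ (hF : Literature.NumberTheory.Automorphic.isCompact_glFiniteIntegralLevel 2 K) (π : Literature.NumberTheory.Automorphic.CuspidalAutomorphicRepData 2 K hF), π.1.HasWeightZero ∧ ∀ᶠ w : IsDedekindDomain.HeightOneSpectrum (NumberField.RingOfIntegers K) in Filter.cofinite, ∃ α : Multiset ℂ, π.1.HasSatakeParamAt w α ∧ ((Real.sqrt w.residueCard : ℝ) : ℂ) * α.sum = (Literature.NumberTheory.Automorphic.frobTraceAt E w : ℂ)) := by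
    rintro (hCM | hj)
    · exact Or.inl hCM
    · exact bridge hj
  rcases h5' with h8 | h12
  · rcases h3' with hb3 | hs3
    · refine finish (hA K hK hd hr E hΔ ⟨ρ3, e3, hb3⟩ ⟨ρ5, e5, h8⟩ ?_)
      rcases h7' with hb7 | he7
      · exact Or.inl ⟨ρ7, e7, hb7⟩
      · exact Or.inr ⟨ρ7, e7, he7⟩
    · exact finish (hC K hK hd hr E hΔ ⟨ρ3, e3, hs3⟩ ⟨ρ5, e5, h8⟩)
  · rcases h7' with hb7 | he7
    · exact finish (hB7 K hK hd hr E hΔ ⟨ρ5, e5, h12⟩ ⟨ρ7, e7, hb7⟩)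
    · rcases h3' with hb3 | hs3
      · exact finish (hE K hK hd hr E hΔ ⟨ρ3, e3, hb3⟩ ⟨ρ7, e7, he7⟩)
      · exact finish (hD K hK hd hr E hΔ ⟨ρ3, e3, hs3⟩ ⟨ρ5, e5, h12⟩)

/-- **The route's `Target` from the five finite certificates and seven named print facts**: every
elliptic curve over every totally real quartic number field is modular (trace-only sense), GIVEN
the five certificates (hypotheses `hA … hE`, see `refinedLocusModular_of_certificates`), the bridge
facts `FLS2015_theorem1` + solvable base change, and `Box2022_theorem1_1`,
`Box2022_theorem1_5_modular`, `FLS2015_theorem3`, `FLS2015_theorem4`, `Kalyanswamy2018_theorem1_2`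
(`target_of_refinedLocusModular_of_facts`).  CONDITIONAL; nothing here proves modularity of any
curve. [cite: Box2022, Thms. 1.1, 1.5 and 7.1] -/
theorem target_of_certificates_of_facts
    (hA : ∀ (K : Type) [Field K] [NumberField K], NumberField.IsTotallyReal K → Module.finrank ℚ K = 4 → (∃ r : K, r ^ 2 = 5) →
        ∀ E : WeierstrassCurve (NumberField.RingOfIntegers K), E.Δ ≠ 0 →
          (∃ ρ : Literature.NumberTheory.GaloisRepresentations.FramedGaloisRep K (ZMod 3) 2, (∃ e : (E.baseChange K).geomTorsion ((3 : ℕ) : ℤ) ≃+ (Fin 2 → ZMod 3), ∀ (σ : Field.absoluteGaloisGroup K) (P : (E.baseChange K).geomTorsion ((3 : ℕ) : ℤ)), e (σ • P) = ((ρ σ : GL (Fin 2) (ZMod 3)) : Matrix (Fin 2) (Fin 2) (ZMod 3)) *ᵥ (e P)) ∧ ((∀ σ : Field.absoluteGaloisGroup K, (((ρ σ : GL (Fin 2) (ZMod 3)) : Matrix (Fin 2) (Fin 2) (ZMod 3)) 1 0 = 0)))) →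
          (∃ ρ : Literature.NumberTheory.GaloisRepresentations.FramedGaloisRep K (ZMod 5) 2, (∃ e : (E.baseChange K).geomTorsion ((5 : ℕ) : ℤ) ≃+ (Fin 2 → ZMod 5), ∀ (σ : Field.absoluteGaloisGroup K) (P : (E.baseChange K).geomTorsion ((5 : ℕ) : ℤ)), e (σ • P) = ((ρ σ : GL (Fin 2) (ZMod 5)) : Matrix (Fin 2) (Fin 2) (ZMod 5)) *ᵥ (e P)) ∧ ((∀ σ : Field.absoluteGaloisGroup K, (ρ σ : GL (Fin 2) (ZMod 5)) ∈ Subgroup.closure ({(⟨!![2, 0; 0, 3], !![3, 0; 0, 2], by decide, by decide⟩ : GL (Fin 2) (ZMod 5)), (⟨!![0, 1; 1, 0], !![0, 1; 1, 0], by decide, by decide⟩ : GL (Fin 2) (ZMod 5))} : Set (GL (Fin 2) (ZMod 5)))))) →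
          ((∃ ρ : Literature.NumberTheory.GaloisRepresentations.FramedGaloisRep K (ZMod 7) 2, (∃ e : (E.baseChange K).geomTorsion ((7 : ℕ) : ℤ) ≃+ (Fin 2 → ZMod 7), ∀ (σ : Field.absoluteGaloisGroup K) (P : (E.baseChange K).geomTorsion ((7 : ℕ) : ℤ)), e (σ • P) = ((ρ σ : GL (Fin 2) (ZMod 7)) : Matrix (Fin 2) (Fin 2) (ZMod 7)) *ᵥ (e P)) ∧ ((∀ σ : Field.absoluteGaloisGroup K, (((ρ σ : GL (Fin 2) (ZMod 7)) : Matrix (Fin 2) (Fin 2) (ZMod 7)) 1 0 = 0)))) ∨ (∃ ρ : Literature.NumberTheory.GaloisRepresentations.FramedGaloisRep K (ZMod 7) 2, (∃ e : (E.baseChange K).geomTorsion ((7 : ℕ) : ℤ) ≃+ (Fin 2 → ZMod 7), ∀ (σ : Field.absoluteGaloisGroup K) (P : (E.baseChange K).geomTorsion ((7 : ℕ) : ℤ)), e (σ • P) = ((ρ σ : GL (Fin 2) (ZMod 7)) : Matrix (Fin 2) (Fin 2) (ZMod 7)) *ᵥ (e P)) ∧ ((∀ σ : Field.absoluteGaloisGroup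 K, (ρ σ : GL (Fin 2) (ZMod 7)) ∈ Subgroup.closure ({(⟨!![0, 5; 3, 0], !![0, 5; 3, 0], by decide, by decide⟩ : GL (Fin 2) (ZMod 7)), (⟨!![5, 0; 3, 2], !![3, 0; 6, 4], by decide, by decide⟩ : GL (Fin 2) (ZMod 7))} : Set (GL (Fin 2) (ZMod 7))))))) →
          ((E.baseChange K).HasCM ∨ (∃ r : K, r ^ 2 = 5 ∧ ∃ a b : ℚ, (E.baseChange K).c₄ ^ 3 = ((a : K) + (b : K) * r) * (E.baseChange K).Δ)))
    (hB7 : ∀ (K : Type) [Field K] [NumberField K], NumberField.IsTotallyReal K → Module.finrank ℚ K = 4 → (∃ r : K, r ^ 2 = 5) →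
        ∀ E : WeierstrassCurve (NumberField.RingOfIntegers K), E.Δ ≠ 0 →
          (∃ ρ : Literature.NumberTheory.GaloisRepresentations.FramedGaloisRep K (ZMod 5) 2, (∃ e : (E.baseChange K).geomTorsion ((5 : ℕ) : ℤ) ≃+ (Fin 2 → ZMod 5), ∀ (σ : Field.absoluteGaloisGroup K) (P : (E.baseChange K).geomTorsion ((5 : ℕ) : ℤ)), e (σ • P) = ((ρ σ : GL (Fin 2) (ZMod 5)) : Matrix (Fin 2) (Fin 2) (ZMod 5)) *ᵥ (e P)) ∧ ((∀ σ : Field.absoluteGaloisGroup K, (ρ σ : GL (Fin 2) (ZMod 5)) ∈ Subgroup.closure ({(⟨!![3, 1; 3, 3], !![3, 4; 2, 3], by decide, by decide⟩ : GL (Fin 2) (ZMod 5)), (⟨!![1, 0; 0, 4], !![1, 0; 0, 4], by decide, by decide⟩ : GL (Fin 2) (ZMod 5))} : Set (GL (Fin 2) (ZMod 5)))))) →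
          (∃ ρ : Literature.NumberTheory.GaloisRepresentations.FramedGaloisRep K (ZMod 7) 2, (∃ e : (E.baseChange K).geomTorsion ((7 : ℕ) : ℤ) ≃+ (Fin 2 → ZMod 7), ∀ (σ : Field.absoluteGaloisGroup K) (P : (E.baseChange K).geomTorsion ((7 : ℕ) : ℤ)), e (σ • P) = ((ρ σ : GL (Fin 2) (ZMod 7)) : Matrix (Fin 2) (Fin 2) (ZMod 7)) *ᵥ (e P)) ∧ ((∀ σ : Field.absoluteGaloisGroup K, (((ρ σ : GL (Fin 2) (ZMod 7)) : Matrix (Fin 2) (Fin 2) (ZMod 7)) 1 0 = 0)))) →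
          ((E.baseChange K).HasCM ∨ (∃ r : K, r ^ 2 = 5 ∧ ∃ a b : ℚ, (E.baseChange K).c₄ ^ 3 = ((a : K) + (b : K) * r) * (E.baseChange K).Δ)))
    (hC : ∀ (K : Type) [Field K] [NumberField K], NumberField.IsTotallyReal K → Module.finrank ℚ K = 4 → (∃ r : K, r ^ 2 = 5) →
        ∀ E : WeierstrassCurve (NumberField.RingOfIntegers K), E.Δ ≠ 0 →
          (∃ ρ : Literature.NumberTheory.GaloisRepresentations.FramedGaloisRep K (ZMod 3) 2, (∃ e : (E.baseChange K).geomTorsion ((3 : ℕ) : ℤ) ≃+ (Fin 2 → ZMod 3), ∀ (σ : Field.absoluteGaloisGroup K) (P : (E.baseChange K).geomTorsion ((3 : ℕ) : ℤ)), e (σ • P) = ((ρ σ : GL (Fin 2) (ZMod 3)) : Matrix (Fin 2) (Fin 2) (ZMod 3)) *ᵥ (e P)) ∧ ((∀ σ : Field.absoluteGaloisGroup K, (ρ σ : GL (Fin 2) (ZMod 3)) ∈ Subgroup.closure ({(⟨!![1, 0; 0, 2], !![1, 0; 0, 2], by decide, by decide⟩ : GL (Fin 2) (ZMod 3)), (⟨!![0,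 1; 1, 0], !![0, 1; 1, 0], by decide, by decide⟩ : GL (Fin 2) (ZMod 3))} : Set (GL (Fin 2) (ZMod 3)))))) →
          (∃ ρ : Literature.NumberTheory.GaloisRepresentations.FramedGaloisRep K (ZMod 5) 2, (∃ e : (E.baseChange K).geomTorsion ((5 : ℕ) : ℤ) ≃+ (Fin 2 → ZMod 5), ∀ (σ : Field.absoluteGaloisGroup K) (P : (E.baseChange K).geomTorsion ((5 : ℕ) : ℤ)), e (σ • P) = ((ρ σ : GL (Fin 2) (ZMod 5)) : Matrix (Fin 2) (Fin 2) (ZMod 5)) *ᵥ (e P)) ∧ ((∀ σ : Field.absoluteGaloisGroup K, (ρ σ : GL (Fin 2) (ZMod 5)) ∈ Subgroup.closure ({(⟨!![2, 0; 0, 3], !![3, 0; 0, 2], by decide, by decide⟩ : GL (Fin 2) (ZMod 5)), (⟨!![0, 1; 1, 0], !![0, 1; 1, 0], by decide, by decide⟩ : GL (Fin 2) (ZMod 5))} : Set (GL (Fin 2) (ZMod 5)))))) →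
          ((E.baseChange K).HasCM ∨ (∃ r : K, r ^ 2 = 5 ∧ ∃ a b : ℚ, (E.baseChange K).c₄ ^ 3 = ((a : K) + (b : K) * r) * (E.baseChange K).Δ)))
    (hD : ∀ (K : Type) [Field K] [NumberField K], NumberField.IsTotallyReal K → Module.finrank ℚ K = 4 → (∃ r : K, r ^ 2 = 5) →
        ∀ E : WeierstrassCurve (NumberField.RingOfIntegers K), E.Δ ≠ 0 →
          (∃ ρ : Literature.NumberTheory.GaloisRepresentations.FramedGaloisRep K (ZMod 3) 2, (∃ e : (E.baseChange K).geomTorsion ((3 : ℕ) : ℤ) ≃+ (Fin 2 → ZMod 3), ∀ (σ : Field.absoluteGaloisGroup K) (P : (E.baseChange K).geomTorsion ((3 : ℕ) : ℤ)), e (σ • P) = ((ρ σ : GL (Fin 2) (ZMod 3)) : Matrix (Fin 2) (Fin 2) (ZMod 3)) *ᵥ (e P)) ∧ ((∀ σ : Field.absoluteGaloisGroup K, (ρ σ : GL (Fin 2) (ZMod 3)) ∈ Subgroup.closure ({(⟨!![1, 0; 0, 2], !![1, 0; 0, 2], by decide, by decide⟩ : GL (Fin 2) (ZMod 3)), (⟨!![0,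 1; 1, 0], !![0, 1; 1, 0], by decide, by decide⟩ : GL (Fin 2) (ZMod 3))} : Set (GL (Fin 2) (ZMod 3)))))) →
          (∃ ρ : Literature.NumberTheory.GaloisRepresentations.FramedGaloisRep K (ZMod 5) 2, (∃ e : (E.baseChange K).geomTorsion ((5 : ℕ) : ℤ) ≃+ (Fin 2 → ZMod 5), ∀ (σ : Field.absoluteGaloisGroup K) (P : (E.baseChange K).geomTorsion ((5 : ℕ) : ℤ)), e (σ • P) = ((ρ σ : GL (Fin 2) (ZMod 5)) : Matrix (Fin 2) (Fin 2) (ZMod 5)) *ᵥ (e P)) ∧ ((∀ σ : Field.absoluteGaloisGroup K, (ρ σ : GL (Fin 2) (ZMod 5)) ∈ Subgroup.closure ({(⟨!![3, 1; 3, 3], !![3, 4; 2, 3], by decide, by decide⟩ : GL (Fin 2) (ZMod 5)), (⟨!![1, 0; 0, 4], !![1, 0; 0, 4], by decide, by decide⟩ : GL (Fin 2) (ZMod 5))} : Set (GL (Fin 2) (ZMod 5)))))) →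
          ((E.baseChange K).HasCM ∨ (∃ r : K, r ^ 2 = 5 ∧ ∃ a b : ℚ, (E.baseChange K).c₄ ^ 3 = ((a : K) + (b : K) * r) * (E.baseChange K).Δ)))
    (hE : ∀ (K : Type) [Field K] [NumberField K], NumberField.IsTotallyReal K → Module.finrank ℚ K = 4 → (∃ r : K, r ^ 2 = 5) →
        ∀ E : WeierstrassCurve (NumberField.RingOfIntegers K), E.Δ ≠ 0 →
          (∃ ρ : Literature.NumberTheory.GaloisRepresentations.FramedGaloisRep K (ZMod 3) 2, (∃ e : (E.baseChange K).geomTorsion ((3 : ℕ) : ℤ) ≃+ (Fin 2 → ZMod 3), ∀ (σ : Field.absoluteGaloisGroup K) (P : (E.baseChange K).geomTorsion ((3 : ℕ) : ℤ)), e (σ • P) = ((ρ σ : GL (Fin 2) (ZMod 3)) : Matrix (Fin 2) (Fin 2) (ZMod 3)) *ᵥ (e P)) ∧ ((∀ σ : Field.absoluteGaloisGroup K, (((ρ σ : GL (Fin 2) (ZMod 3)) : Matrix (Fin 2) (Fin 2) (ZMod 3)) 1 0 = 0)))) →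
          (∃ ρ : Literature.NumberTheory.GaloisRepresentations.FramedGaloisRep K (ZMod 7) 2, (∃ e : (E.baseChange K).geomTorsion ((7 : ℕ) : ℤ) ≃+ (Fin 2 → ZMod 7), ∀ (σ : Field.absoluteGaloisGroup K) (P : (E.baseChange K).geomTorsion ((7 : ℕ) : ℤ)), e (σ • P) = ((ρ σ : GL (Fin 2) (ZMod 7)) : Matrix (Fin 2) (Fin 2) (ZMod 7)) *ᵥ (e P)) ∧ ((∀ σ : Field.absoluteGaloisGroup K, (ρ σ : GL (Fin 2) (ZMod 7)) ∈ Subgroup.closure ({(⟨!![0, 5; 3, 0], !![0, 5; 3, 0], by decide, by decide⟩ : GL (Fin 2) (ZMod 7)), (⟨!![5, 0; 3, 2], !![3, 0; 6, 4], by decide, by decide⟩ : GL (Fin 2) (ZMod 7))} : Set (GL (Fin 2) (ZMod 7)))))) →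
          ((E.baseChange K).HasCM ∨ (∃ r : K, r ^ 2 = 5 ∧ ∃ a b : ℚ, (E.baseChange K).c₄ ^ 3 = ((a : K) + (b : K) * r) * (E.baseChange K).Δ)))
    (hFLS : FLS2015_theorem1)
    (hBC : isModularEllipticCurve_baseChange_of_isSolvable_of_isAutomorphicOfWeightZero)
    (h11 : Box2022_theorem1_1) (h15 : Box2022_theorem1_5_modular) (h3 : FLS2015_theorem3)
    (h4 : FLS2015_theorem4) (hKal : Kalyanswamy2018_theorem1_2) : Target :=
  target_of_refinedLocusModular_of_facts (refinedLocusModular_of_certificates hA hB7 hC hD hE hFLS hBC)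
    h11 h15 h3 h4 hKal

end Summit.Langlands.Langlands.Theorems.SqrtFiveQuarticCovers
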